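import Literature.Geometry.Lorentzian.SpacetimeConstSmul
import Literature.Geometry.Lorentzian.NullInwardPencil
import HarnessLib

/-!
# Constant rescaling (dilation) of vacuum Cauchy developments

If `𝒟 = (M, g, τ, ι, ν)` is a vacuum Cauchy development of the initial data set `D = (h, k)` on `X`
and `c > 0`, then `(M, c² g, τ, ι, c⁻¹ ν)` is a vacuum Cauchy development of the dilated data
`D' = (c² h, c k)` (`VacuumCauchyDevelopment.constSmul`): the induced metric is `c² ι^* g = c² h`,
the future unit normal of `c² g` is `c⁻¹ ν`, its second fundamental form is
`K^{c² g}_{c⁻¹ ν} = c⁻¹ c² K^g_ν = c k` (the Levi-Civita connection is unchanged under constant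
rescaling, O'Neill 1983, Ch. 3, Thm. 3.11), the image `ι(X)` is a Cauchy hypersurface of `c² g`
(same timelike curves) and `Ric(c² g) = Ric(g) = 0`. Moreover maximality is preserved
(`VacuumCauchyDevelopment.isMaximal_constSmul`): a vacuum Cauchy development of `D'` descales to one of
`D`, embeds into `𝒟` by maximality, and the same map is an embedding of developments into the rescaled
`𝒟` (isometric immersions and time-orientation preservation are unchanged when both metrics are
rescaled). This is the scaling covariance of the Cauchy problem for the vacuum Einstein equations
(Bartnik–Isenberg 2004, §2: the constraints are homogeneous under `(h, k) ↦ (c² h, c k)`;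
Choquet-Bruhat–Geroch 1969 / Ringström 2009, Def. 16.5: maximal developments).

## References

* B. O'Neill, *Semi-Riemannian geometry with applications to relativity*, 1983, Ch. 3, Thm. 3.11;
  Ch. 4, Lemma 4.4 ff. [ONeill1983]
* R. Bartnik, J. Isenberg, *The constraint equations* (2004), §2. [BartnikIsenberg2004]
* H. Ringström, *The Cauchy Problem in General Relativity*, EMS 2009, Def. 16.2–16.5. [Ringstrom2009]
-/

noncomputable section

open Manifold Bundle TopologicalSpace Set
open scoped ContDiff Topology

universe u

namespace Literature.Geometry.Lorentzian

variable {n : ℕ} {X : Type u} [TopologicalSpace X] [ChartedSpace (EuclideanSpace ℝ (Fin n)) X]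
  [IsManifold (𝓡 n) ∞ X] [ConnectedSpace X] {D : InitialDataSet (𝓡 n) X}

namespace VacuumCauchyDevelopment

/-- **The dilated vacuum Cauchy development.** For a vacuum Cauchy development
`𝒟 = (M, g, τ, ι, ν)` of `D = (h, k)` and `c > 0`, the tuple `(M, c² g, τ, ι, c⁻¹ ν)` is a vacuum
Cauchy development of any data set `D'` with `h' = c² h`, `k' = c k` pointwise: `ι^*(c² g) = c² h`;
`c⁻¹ ν` is the future unit normal of `c² g` (`isFutureUnitNormal_constSmul_iff`);
`K^{c² g}_{c⁻¹ν} = c k` (`secondFundamentalForm_constSmul`, `secondFundamentalForm_const_smul`: same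
Levi-Civita connection, O'Neill 1983, Ch. 3, Thm. 3.11); `ι(X)` is a Cauchy hypersurface of
`(c² g, τ)` (`isCauchyHypersurface_constSmul_iff`); `Ric(c² g) = Ric(g) = 0`
(`isRicciFlat_constSmul_iff`). An `abbrev`, so that the carrier, metric and embedding of the dilate
unfold by `rfl`. Bartnik–Isenberg 2004, §2 (scaling of the constraints); Ringström 2009,
Def. 16.2–16.3. [cite: BartnikIsenberg2004, §2] -/
abbrev constSmul (𝒟 : VacuumCauchyDevelopment D) (c : ℝ) (hc : 0 < c) (D' : InitialDataSet (𝓡 n) X)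
    (hh : ∀ (x : X) (v w : TangentSpace (𝓡 n) x), D'.h.inner x v w = c ^ 2 * D.h.inner x v w)
    (hk : ∀ (x : X) (v w : TangentSpace (𝓡 n) x), D'.k x v w = c * D.k x v w) :
    VacuumCauchyDevelopment D' where
  toSpacetime := 𝒟.toSpacetime.constSmul (c ^ 2) (pow_pos hc 2)
  embed := 𝒟.embed
  isSmoothEmbedding := 𝒟.isSmoothEmbedding
  normal := c⁻¹ • 𝒟.normal
  isFutureUnitNormal :=
    (𝒟.metric.isFutureUnitNormal_constSmul_iff 𝒟.timeOrientation hc 𝒟.embed 𝒟.normal).2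
      𝒟.isFutureUnitNormal
  induced_h y := by
    change pullbackBilin (I := 𝓡 (n + 1)) (I' := 𝓡 n) (M := 𝒟.carrier) 𝒟.embed
      (fun x ↦ (c ^ 2) • 𝒟.metric.val x) y = D'.h.inner y
    rw [pullbackBilin_const_smul, 𝒟.induced_h y]
    ext v w
    rw [hh]
    rfl
  induced_k := by
    intro inst y
    have hc2 : (c ^ 2 : ℝ) ≠ 0 := (pow_pos hc 2).ne'
    haveI i1 : (𝒟.metric.toPseudoRiemannianMetric.constSmul (c ^ 2) hc2).HasLeviCivita := inst
    haveI i2 : 𝒟.metric.toPseudoRiemannianMetric.HasLeviCivita :=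
      PseudoRiemannianMetric.hasLeviCivita_of_constSmul _ hc2
    change (𝒟.metric.toPseudoRiemannianMetric.constSmul (c ^ 2) hc2).secondFundamentalForm (𝓡 n)
      𝒟.embed (c⁻¹ • 𝒟.normal) y = D'.kBilin y
    rw [PseudoRiemannianMetric.secondFundamentalForm_const_smul,
      PseudoRiemannianMetric.secondFundamentalForm_constSmul, 𝒟.induced_k y, smul_smul]
    refine LinearMap.ext₂ fun v w ↦ ?_
    rw [LinearMap.smul_apply, LinearMap.smul_apply, InitialDataSet.kBilin_apply,
      InitialDataSet.kBilin_apply, hk, smul_eq_mul]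
    field_simp
  isCauchyHypersurface :=
    (𝒟.metric.isCauchyHypersurface_constSmul_iff 𝒟.timeOrientation (pow_pos hc 2) _).2
      𝒟.isCauchyHypersurface
  isRicciFlat := by
    intro inst
    have hc2 : (c ^ 2 : ℝ) ≠ 0 := (pow_pos hc 2).ne'
    haveI i1 : (𝒟.metric.toPseudoRiemannianMetric.constSmul (c ^ 2) hc2).HasLeviCivita := inst
    haveI i2 : 𝒟.metric.toPseudoRiemannianMetric.HasLeviCivita :=
      PseudoRiemannianMetric.hasLeviCivita_of_constSmul _ hc2
    exact (PseudoRiemannianMetric.isRicciFlat_constSmul_iff 𝒟.metric.toPseudoRiemannianMetric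
      hc2).2 𝒟.isRicciFlat

variable (𝒟 : VacuumCauchyDevelopment D) {c : ℝ} (hc : 0 < c) {D' : InitialDataSet (𝓡 n) X}
  (hh : ∀ (x : X) (v w : TangentSpace (𝓡 n) x), D'.h.inner x v w = c ^ 2 * D.h.inner x v w)
  (hk : ∀ (x : X) (v w : TangentSpace (𝓡 n) x), D'.k x v w = c * D.k x v w)

/-- The spacetime of the dilated development is the rescaled spacetime `(M, c² g, τ)`. [folklore] -/
lemma toSpacetime_constSmul :
    (𝒟.constSmul c hc D' hh hk).toSpacetime = 𝒟.toSpacetime.constSmul (c ^ 2) (pow_pos hc 2) := rfl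

/-- The dilated development has the same carrier. [folklore] -/
lemma carrier_constSmul : (𝒟.constSmul c hc D' hh hk).carrier = 𝒟.carrier := rfl

/-- The metric of the dilated development is `c² g`. [folklore] -/
lemma metric_constSmul :
    (𝒟.constSmul c hc D' hh hk).metric = 𝒟.metric.constSmul (c ^ 2) (pow_pos hc 2) := rfl

/-- The time orientation of the dilated development is the rescaled one (same vector field). [folklore] -/
lemma timeOrientation_constSmul :
    (𝒟.constSmul c hc D' hh hk).timeOrientation =
      𝒟.timeOrientation.constSmul (c ^ 2) (pow_pos hc 2) := rfl

/-- The dilated development has the same embedding `ι`. [folklore] -/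
lemma embed_constSmul : (𝒟.constSmul c hc D' hh hk).embed = 𝒟.embed := rfl

/-- The future unit normal of the dilated development is `c⁻¹ ν`. [folklore] -/
lemma normal_constSmul : (𝒟.constSmul c hc D' hh hk).normal = c⁻¹ • 𝒟.normal := rfl

/-- **Maximality is preserved under dilation.** If `𝒟` is a maximal vacuum Cauchy development of
`D`, then its dilate is a maximal vacuum Cauchy development of `D' = (c² h, c k)`: a vacuum Cauchy
development `𝒟''` of `D'` descales (by `c⁻¹`) to one of `D`, which embeds into `𝒟` by maximality
through some `ψ`; the same `ψ` embeds `𝒟''` into the dilate of `𝒟`, because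
`ψ^*(c² g) = c² ψ^* g = c² c⁻² g'' = g''` and future cones are unchanged. Choquet-Bruhat–Geroch
1969; Ringström 2009, Def. 16.5; Bartnik–Isenberg 2004, §2. [cite: Ringstrom2009, Def. 16.5] -/
theorem isMaximal_constSmul (h𝒟 : 𝒟.IsMaximal) : (𝒟.constSmul c hc D' hh hk).IsMaximal := by
  intro 𝒟''
  have hc0 : c ≠ 0 := hc.ne'
  have hh' : ∀ (x : X) (v w : TangentSpace (𝓡 n) x),
      D.h.inner x v w = c⁻¹ ^ 2 * D'.h.inner x v w := fun x v w ↦ by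
    rw [hh]; field_simp
  have hk' : ∀ (x : X) (v w : TangentSpace (𝓡 n) x), D.k x v w = c⁻¹ * D'.k x v w :=
    fun x v w ↦ by rw [hk]; field_simp
  obtain ⟨ψ, hψs, hψo, hψi, hψτ, hψι⟩ := h𝒟 (𝒟''.constSmul c⁻¹ (inv_pos.2 hc) D hh' hk')
  refine ⟨ψ, hψs, hψo, ⟨hψi.1, fun y ↦ ?_⟩, fun y ↦ ?_, hψι⟩
  · have h2 := hψi.2 y
    change pullbackBilin (I := 𝓡 (n + 1)) (I' := 𝓡 (n + 1)) ψ
      (fun x ↦ (c ^ 2) • 𝒟.metric.val x) y = 𝒟''.metric.val y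
    rw [pullbackBilin_const_smul, h2]
    change (c ^ 2) • ((c⁻¹ ^ 2) • 𝒟''.metric.val y) = _
    rw [smul_smul, show c ^ 2 * c⁻¹ ^ 2 = 1 by field_simp, one_smul]
  · exact (𝒟.timeOrientation.isFutureDirected_constSmul_iff (pow_pos hc 2) _).2 (hψτ y)

end VacuumCauchyDevelopment

end Literature.Geometry.Lorentzian

end
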